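import Literature.NumberTheory.LFunctions.WeilTwoPrimeDeflM72YBase
import Literature.NumberTheory.LFunctions.WeilTwoPrimeDeflM72YDataPO23
import Literature.NumberTheory.LFunctions.WeilBlockRowsPZ
import Literature.NumberTheory.LFunctions.WeilBlockRowsFast
import Literature.NumberTheory.LFunctions.WeilTwoPrimeOddMarginHDataDn12
import HarnessLib

/-!
# Deflated two-prime certificate M72Y: dominance of rows 46–47 of `R = S''_odd(κ') − UᵀU` (factored data)

`WeilCert.checkDomRowPZ` with the materialized augmented block, the factored inverse `weilCert23HDn/weilCert23HLs` and the Bessel block, by `decide +kernel` row by row. Pure proof file.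
-/

noncomputable section

namespace Literature.NumberTheory.LFunctions

set_option maxHeartbeats 0 in
/-- Kernel check of the dominance of row 46 of `R` (odd block, certificate M72Y). [folklore] -/
theorem checkDomRowF1_46_weilCertDeflM72Y :
    weilCertDeflM72YBase.checkDomRowF weilCertDeflM72YPmO weilCert23HDn weilCert23HLs weilCertDeflM72YHpO weilCertDeflM72YKappa' 1 46 = true := by
  decide +kernel

/-- Kernel check of the dominance of row 46 of `R` (certificate M72Y, factored data), from the fast row. [folklore] -/
theorem checkDomRowPZ1_46_weilCertDeflM72Y :
    weilCertDeflM72YBase.checkDomRowPZ weilCertDeflM72YPmO weilCert23HDn weilCert23HLs weilCertDeflM72YHpO weilCertDeflM72YKappa' 1 46 = true :=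
  WeilCert.checkDomRowPZ_of_F (by decide) checkDomRowF1_46_weilCertDeflM72Y

set_option maxHeartbeats 0 in
/-- Kernel check of the dominance of row 47 of `R` (odd block, certificate M72Y). [folklore] -/
theorem checkDomRowF1_47_weilCertDeflM72Y :
    weilCertDeflM72YBase.checkDomRowF weilCertDeflM72YPmO weilCert23HDn weilCert23HLs weilCertDeflM72YHpO weilCertDeflM72YKappa' 1 47 = true := by
  decide +kernel

/-- Kernel check of the dominance of row 47 of `R` (certificate M72Y, factored data), from the fast row. [folklore] -/
theorem checkDomRowPZ1_47_weilCertDeflM72Y :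
    weilCertDeflM72YBase.checkDomRowPZ weilCertDeflM72YPmO weilCert23HDn weilCert23HLs weilCertDeflM72YHpO weilCertDeflM72YKappa' 1 47 = true :=
  WeilCert.checkDomRowPZ_of_F (by decide) checkDomRowF1_47_weilCertDeflM72Y


end Literature.NumberTheory.LFunctions
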